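import Literature.AlgebraicGeometry.Resolution.DivisorialPart
import Literature.AlgebraicGeometry.Resolution.RegularCentreComponents
import HarnessLib

/-!
# Crux `PatchingRelPerfect` (stmt-ResolutionOfSingularities-16161), chain w52 — programme r-d1,
# piece S-A2: DIVISORIAL FACTORISATION of a locally principal ideal sheaf on a regular scheme
# (`DivisorialFactorization` of plan-1's typed targets E, verbatim binder shape)

[OURS · L1 W5.2 · rung tool] CHAIN.md v1.5 §2 / `ChainW52TargetsE.lean` (9d67ec503d849faa) l.444–461,
target **S-A2 `DivisorialFactorization`** (fact-free): let `E` be a regular integral Noetherian scheme,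
`𝔟 ≠ 0` a LOCALLY PRINCIPAL ideal sheaf, and `s` a finite set of closed subsets `D` such that each
`𝓘(D) = vanishingIdeal D` is an effective Cartier divisor with `V(𝓘(D))` a regular scheme, and
`Supp 𝔟 ⊆ ⋃_{D ∈ s} D`.  Then `𝔟` is REGULAR-DIVISORIAL: a finite product (with repetitions) of
effective Cartier ideal sheaves with regular closed subscheme — namely `𝔟 = ∏_α 𝓘(P_α)^{a_α}` over
the codimension-one points `ζ_α` of `V(𝔟)` (`P_α = cl{ζ_α}`, `a_α = ord_{ζ_α} 𝔟`).

Assembly of tree results (no unique factorisation beyond Auslander–Buchsbaum in the stalks, which the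
tree's divisorial part already uses):
* Cossart–Piltant 2008, proof of Prop. 4.2 (tree `DivisorialPart.lean`): `𝔟 = H · J` with
  `H = ∏_α 𝓘(P_α)^{a_α}` (`divisorialPart`) and `J = ⊤` iff `𝔟` is locally principal
  (`isLocallyPrincipal_iff_codimTwoPart_eq_top`) — so here `𝔟 = H`;
* each `𝓘(P_α)` is an effective Cartier divisor (`isEffectiveCartier_primeDivisorIdeal_of_isRegular`,
  Görtz–Wedhorn I, Thm. 11.40 (2));
* each `P_α` is an IRREDUCIBLE COMPONENT of some `D ∈ s` (a codimension-one irreducible closed subset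
  of a proper closed `D ⊇ P_α` is maximal among the irreducible subsets of `D`), and the components of
  a regular `V(𝓘(D))` are pairwise disjoint with regular reduced structure (tree
  `RegularCentreComponents.lean`, Stacks 0357), so `V(𝓘(P_α))` is regular.

PROVED: `DepthOne.divisorialFactorization` (the target's statement with its conclusion
`IsRegularDivisorial 𝔟` unfolded — the by-name one-liner follows once plan-1's `…DepthOneTargets.lean`
is in the tree), with the helpers `DepthOne.not_isEffectiveCartier_bot`,
`DepthOne.closure_singleton_mem_componentsIn`, `DepthOne.isRegular_subscheme_primeDivisorIdeal` and
`DepthOne.exists_list_of_finset_prod_pow`.  Nothing here is a statement of the manuscript under review.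

## References

* V. Cossart, O. Piltant, *Resolution of singularities of threefolds in positive characteristic. I*,
  J. Algebra 320 (2008) 1051–1082, proof of Prop. 4.2 (PDF p. 7). [CossartPiltant2008]
* U. Görtz, T. Wedhorn, *Algebraic Geometry I*, 2nd ed. (2020), Thm. 11.40 (2). [GortzWedhorn2020]
* The Stacks Project, Tags 0357, 0BE1. [StacksProject]
* J. Kollár, *Lectures on Resolution of Singularities* (2007), (3.111) Step 3. [Kollar2007]
-/

-- `Summit.<Summit>.<Sub>.Theorems` with `Sub = Summit` (single-conjunct summit, D-0017)
set_option linter.dupNamespace false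

noncomputable section

open CategoryTheory AlgebraicGeometry TopologicalSpace Literature.AlgebraicGeometry.Resolution
open Scheme.IdealSheafData (vanishingIdeal)

namespace Summit.ResolutionOfSingularities.ResolutionOfSingularities.Theorems

namespace DepthOne

universe u

variable {E : Scheme.{u}}

/-- The zero ideal sheaf of a non-empty scheme is not an effective Cartier divisor (a local
generator would be the zero element, which is a zero-divisor of the non-trivial ring of sections of an
affine open containing a point). [cite: GortzWedhorn2020, (13.19) p. 413] -/
theorem not_isEffectiveCartier_bot [Nonempty E] : ¬ IsEffectiveCartier (⊥ : E.IdealSheafData) := by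
  intro h
  obtain ⟨x⟩ := ‹Nonempty E›
  obtain ⟨U, hxU, f, hf, hfU⟩ := h x
  haveI : Nonempty (U : E.Opens) := ⟨⟨x, hxU⟩⟩
  rw [Scheme.IdealSheafData.ideal_bot, Pi.bot_apply, eq_comm, Ideal.span_singleton_eq_bot] at hfU
  rw [hfU] at hf
  exact zero_notMem_nonZeroDivisors hf

/-- A closed subset whose vanishing ideal sheaf is an effective Cartier divisor is a proper subset
(on an integral scheme the vanishing ideal of the whole space is `0`). [folklore] -/
theorem coe_ne_univ_of_isEffectiveCartier_vanishingIdeal [IsIntegral E] {D : Closeds E}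
    (hD : IsEffectiveCartier (vanishingIdeal D)) : (D : Set E) ≠ Set.univ := by
  intro h
  have hD' : D = ⊤ := SetLike.coe_injective (by simpa using h)
  rw [hD', Scheme.IdealSheafData.vanishingIdeal_top, Scheme.nilradical_eq_bot] at hD
  exact not_isEffectiveCartier_bot hD

/-- **The closure of a codimension-one point is an irreducible component of every proper closed set
containing it**: an irreducible `T` with `cl{ζ} ⊆ T ⊆ D` has a generic point `η ⤳ ζ`; if `η ≠ ζ`
then `η` has codimension zero, i.e. is the generic point of the (irreducible) scheme, and
`D ⊇ cl T = E`. [cite: StacksProject, Tag 0BE1] -/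
theorem closure_singleton_mem_componentsIn [IrreducibleSpace E] {ζ : E} (hζ : Order.coheight ζ = 1)
    {D : Set E} (hD : IsClosed D) (hDne : D ≠ Set.univ) (hζD : ζ ∈ D) :
    closure {ζ} ∈ componentsIn D := by
  rw [mem_componentsIn_iff]
  refine ⟨closure_minimal (Set.singleton_subset_iff.mpr hζD) hD, isIrreducible_singleton.closure,
    fun T hTD hT hζT => ?_⟩
  obtain ⟨η, hη⟩ := QuasiSober.sober hT.closure isClosed_closure
  have hζT' : ζ ∈ closure T := subset_closure (hζT (subset_closure rfl))
  have hηζ : η ⤳ ζ := hη.specializes hζT'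
  by_cases h0 : Order.coheight η = 0
  · exfalso
    apply hDne
    have hηgen : η = genericPoint E := eq_genericPoint_of_coheight_eq_zero h0
    have hclT : closure T = Set.univ := by
      rw [← hη.def, hηgen]
      exact genericPoint_closure E
    exact Set.eq_univ_of_univ_subset (hclT ▸ closure_minimal hTD hD)
  · have hle : Order.coheight ζ ≤ Order.coheight η := by
      rw [hζ]
      exact Order.one_le_iff_ne_zero.mpr h0
    have hfin : Order.coheight ζ ≠ ⊤ := by rw [hζ]; exact ENat.coe_ne_top 1
    obtain rfl : η = ζ := eq_of_specializes_of_coheight_le hηζ hfin hle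
    rw [hη.def]
    exact subset_closure

/-- **The prime divisor through a codimension-one point of a regular `V(𝓘(D))` is regular**: for `D`
closed with `𝓘(D)` effective Cartier and `V(𝓘(D))` regular, and `ζ ∈ D` of codimension one, the
reduced closed subscheme `V(𝓘(cl{ζ}))` is regular — `cl{ζ}` is a component of `D`, the components of
the regular `V(𝓘(D))` are pairwise disjoint, and each carries the quotient stalks of `V(𝓘(D))`.
[cite: StacksProject, Tag 0357] -/
theorem isRegular_subscheme_primeDivisorIdeal [IsIntegral E] [IsLocallyNoetherian E]
    [NoetherianSpace E] {D : Closeds E} (hDc : IsEffectiveCartier (vanishingIdeal D))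
    (hDreg : Scheme.IsRegular (vanishingIdeal D).subscheme) {ζ : E} (hζ : Order.coheight ζ = 1)
    (hζD : ζ ∈ (D : Set E)) : Scheme.IsRegular (primeDivisorIdeal ζ).subscheme := by
  have hmem : (⟨closure {ζ}, isClosed_closure⟩ : Closeds E) ∈
      Kollar2007.boundaryPieces (vanishingIdeal D) := by
    rw [Kollar2007.mem_boundaryPieces_iff, Scheme.IdealSheafData.coe_support_vanishingIdeal]
    exact closure_singleton_mem_componentsIn hζ D.isClosed
      (coe_ne_univ_of_isEffectiveCartier_vanishingIdeal hDc) hζD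
  exact isRegular_subscheme_vanishingIdeal_piece hDreg
    (isPiecePartition_boundaryPieces_of_isRegular hDreg) hmem

/-- A finite product of powers of ideal sheaves each satisfying a property `p` is the product of a
LIST of ideal sheaves each satisfying `p` (bookkeeping for `IsRegularDivisorial`). [folklore] -/
theorem exists_list_of_finset_prod_pow {ι : Type*} (t : Finset ι) (K : ι → E.IdealSheafData)
    (n : ι → ℕ) (p : E.IdealSheafData → Prop) (hp : ∀ i ∈ t, p (K i)) :
    ∃ l : List E.IdealSheafData, (∀ D ∈ l, p D) ∧ (∏ i ∈ t, K i ^ n i) = l.prod := by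
  classical
  refine Finset.prod_induction (fun i => K i ^ n i)
    (fun J => ∃ l : List E.IdealSheafData, (∀ D ∈ l, p D) ∧ J = l.prod) ?_ ?_ ?_
  · rintro a b ⟨l₁, h₁, rfl⟩ ⟨l₂, h₂, rfl⟩
    refine ⟨l₁ ++ l₂, fun D hD => ?_, List.prod_append.symm⟩
    rcases List.mem_append.mp hD with hD | hD
    · exact h₁ D hD
    · exact h₂ D hD
  · exact ⟨[], fun D hD => by simp at hD, List.prod_nil.symm⟩
  · intro i hi
    refine ⟨List.replicate (n i) (K i), fun D hD => ?_, (List.prod_replicate _ _).symm⟩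
    rw [List.eq_of_mem_replicate hD]
    exact hp i hi

/-- **S-A2 — divisorial factorisation on a regular scheme** (`DivisorialFactorization` of plan-1's
`ChainW52TargetsE.lean`, verbatim binder shape, conclusion `IsRegularDivisorial 𝔟` unfolded): a
non-zero locally principal ideal sheaf `𝔟` on a regular integral Noetherian scheme whose support lies
in a finite union of closed sets `D` with `𝓘(D)` effective Cartier and `V(𝓘(D))` regular is a finite
product of effective Cartier ideal sheaves with regular closed subscheme: `𝔟` equals its divisorial
part `∏_α 𝓘(P_α)^{a_α}` (Cossart–Piltant 2008, proof of Prop. 4.2: the cofactor `J` is the unit ideal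
exactly when `𝔟` is locally principal), the prime divisors `P_α = cl{ζ_α}` are Cartier on the regular
`E` and are components of the `D ∈ s`, hence regular.
[cite: CossartPiltant2008, proof of Prop. 4.2] [cite: GortzWedhorn2020, Thm. 11.40 (2)]
[cite: StacksProject, Tag 0357] [cite: Kollar2007, (3.111) Step 3] -/
theorem divisorialFactorization (E : Scheme.{u}) [IsIntegral E] [IsNoetherian E]
    (hE : Scheme.IsRegular E) (𝔟 : E.IdealSheafData) (h𝔟 : 𝔟 ≠ ⊥) (hlp : IsLocallyPrincipal 𝔟)
    (s : Finset (Closeds E))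
    (hs : ∀ D ∈ s, IsEffectiveCartier (Scheme.IdealSheafData.vanishingIdeal D) ∧
      Scheme.IsRegular (Scheme.IdealSheafData.vanishingIdeal D).subscheme)
    (hsupp : (𝔟.support : Set E) ⊆ ⋃ D ∈ s, (D : Set E)) :
    ∃ l : List E.IdealSheafData,
      (∀ D ∈ l, IsEffectiveCartier D ∧ Scheme.IsRegular D.subscheme) ∧ 𝔟 = l.prod := by
  classical
  have hfin : (divisorialPoints 𝔟).Finite := finite_divisorialPoints h𝔟
  -- `𝔟` is its own divisorial part: the codimension-`≥ 2` cofactor is the unit ideal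
  have hJ : codimTwoPart 𝔟 = ⊤ := (isLocallyPrincipal_iff_codimTwoPart_eq_top hE h𝔟).mp hlp
  have h𝔟eq : 𝔟 = ∏ ζ ∈ hfin.toFinset, primeDivisorIdeal ζ ^ (idealOrder 𝔟 ζ).toNat := by
    have h := divisorialPart_mul_codimTwoPart hE h𝔟
    rw [hJ, Scheme.IdealSheafData.mul_top, divisorialPart_eq hfin] at h
    exact h.symm
  -- every prime divisor occurring is Cartier with regular reduced structure
  have hfac : ∀ ζ ∈ hfin.toFinset,
      IsEffectiveCartier (primeDivisorIdeal ζ) ∧ Scheme.IsRegular (primeDivisorIdeal ζ).subscheme := by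
    intro ζ hζ
    rw [Set.Finite.mem_toFinset, mem_divisorialPoints_iff] at hζ
    obtain ⟨hζsupp, hζ1⟩ := hζ
    refine ⟨isEffectiveCartier_primeDivisorIdeal_of_isRegular hE hζ1, ?_⟩
    obtain ⟨D, hDs, hζD⟩ : ∃ D ∈ s, ζ ∈ (D : Set E) := by
      simpa only [Set.mem_iUnion, exists_prop] using hsupp hζsupp
    obtain ⟨hDc, hDreg⟩ := hs D hDs
    exact isRegular_subscheme_primeDivisorIdeal hDc hDreg hζ1 hζD
  obtain ⟨l, hl, hprod⟩ := exists_list_of_finset_prod_pow hfin.toFinset primeDivisorIdeal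
    (fun ζ => (idealOrder 𝔟 ζ).toNat)
    (fun K => IsEffectiveCartier K ∧ Scheme.IsRegular K.subscheme) hfac
  exact ⟨l, hl, h𝔟eq.trans hprod⟩

end DepthOne

end Summit.ResolutionOfSingularities.ResolutionOfSingularities.Theorems

end
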